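import Literature.Probability.RandomPlanarGeometry.ObservableShortTime
import HarnessLib

/-!
# The spin-5/8 (self-avoiding walk) half-plane observable: continuity and boundedness in the short-time regime

Topic `Literature/Probability/RandomPlanarGeometry` (deterministic chordal Loewner calculus;
theorems only, no definition, no named fact). Sibling of `SAWParaObservableFarField.lean` (the
far-field expansion of the same observable; the two files are independent) and
self-avoiding-walk (`κ = 8/3`) companion of `ObservableShortTime.lean` (FK-Ising observable)
and of the short-time part of `ParaObservableFarField.lean` (percolation).

The spin-`5/8` parafermionic half-plane observable along the chordal Loewner chain `g_t` of a
driving function `W` (Duminil-Copin–Smirnov, Ann. of Math. 175 (2012), §4, Conjecture 2;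
Lawler–Schramm–Werner, Proc. Sympos. Pure Math. 72 (2004), §4.1),
`(w² g_t'(w)/(g_t(w) - W_t)²)^{5/8}`, is written throughout with PRINCIPAL logarithms and NO
new definition,

  `N_t(w) = exp ((5/8) (2 Log w + Log g_t'(w) - 2 Log (g_t(w) - W_t)))`,

so that every statement applies by `rfl` to any definition with this body (e.g. the SAW
route's `paraObs` / `paraObsCap` of the summit `CriticalPhenomena`). Results, all PROVED, in
CDHKS's short-time regime `Loewner.ShortTime W (iy) t` (`W` continuous, `y > 0`, `9t ≤ y²`;
Chelkak–Duminil-Copin–Hongler–Kemppainen–Smirnov, C. R. Math. 352 (2014), §3):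

* `ShortTime.deriv_map_mem_slitPlane`, `ShortTime.map_sub_mem_slitPlane` — both arguments of
  `Log` stay in the slit plane `ℂ ∖ (-∞, 0]`: `g_t'(z) = e^J` with `|Im J| ≤ ‖J‖ ≤ 1/2 < π/2`
  (`ShortTime.norm_exponent_le`), and `Im (g_t(z) - W_t) > 0` (`ShortTime.im_map_sub_pos`);
* `ShortTime.continuousOn_sawParaObservable` — hence `s ↦ N_s(iy)` is continuous on `[0, t]`
  (this is the branch "continuous in `s` from the value `1` at `s = 0`");
* `ShortTime.norm_sawParaObservable_le` — and bounded: `‖N_t(iy)‖ ≤ 4`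
  (`|N| = exp((5/8)(2 log y + Re J - 2 log |g_t - W_t|))`, `Re J ≤ 1/2`,
  `log(y/|g_t - W_t|) ≤ log(3/2) ≤ 1/2`);
* `continuous_sawParaObservable_min`, `norm_sawParaObservable_min_le` — the time-limited path
  `s ↦ N_{s ∧ T}(iy)` is continuous on `[0, ∞)` and bounded by `4` whenever `[0, T]` is in the
  short-time regime (e.g. `T = y²/9`, or the cap `T = y²/16`): the inputs of the martingale
  limit passage for a bounded continuous functional of the driving path.

## Mathlib

USED: `ContinuousOn.clog`, `ContinuousOn.cexp`, `Complex.mem_slitPlane_iff`, `Complex.norm_exp`,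
`Complex.log_re`, `Complex.re_ofReal_mul`, `Real.log_le_sub_one_of_pos`. From the tree:
`Loewner.ShortTime.*`, `Loewner.mul_exp_mem_slitPlane` (`ObservableShortTime.lean`).

## References

* H. Duminil-Copin, S. Smirnov, *The connective constant of the honeycomb lattice equals
  `√(2+√2)`*, Ann. of Math. (2) 175 (2012) 1653–1665, §4, Conjecture 2.
* G. F. Lawler, O. Schramm, W. Werner, *On the scaling limit of planar self-avoiding walk*,
  Proc. Sympos. Pure Math. 72 (2004) 339–364, §4.1.
* D. Chelkak, H. Duminil-Copin, C. Hongler, A. Kemppainen, S. Smirnov, *Convergence of Ising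
  interfaces to Schramm's SLE curves*, C. R. Math. Acad. Sci. Paris 352 (2014) 157–161, §3.
-/

noncomputable section

open Set Filter Topology Metric MeasureTheory Complex
open scoped NNReal

namespace Literature.Probability.RandomPlanarGeometry

namespace Loewner

/-! ### The short-time regime: both logarithms stay on the principal sheet -/

namespace ShortTime

variable {W : ℝ≥0 → ℝ} {z : ℂ} {t : ℝ≥0}

/-- In the short-time regime `g_t'(z) = e^J` with `|Im J| ≤ ‖J‖ ≤ 1/2 < π/2`, so `g_t'(z)` lies in
the slit plane `ℂ ∖ (-∞, 0]` (indeed `Re g_t'(z) > 0`). [folklore] -/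
theorem deriv_map_mem_slitPlane (h : ShortTime W z t) : deriv (map W t) z ∈ slitPlane := by
  obtain ⟨g, hg⟩ := h.exists_sol
  rw [h.deriv_map_eq hg, ← one_mul (cexp _)]
  refine mul_exp_mem_slitPlane (by norm_num) ?_
  refine lt_of_le_of_lt ((abs_im_le_norm _).trans (h.norm_exponent_le hg)) ?_
  linarith [Real.two_le_pi]

/-- In the short-time regime `Im (g_t(z) - W_t) > 0`, so `g_t(z) - W_t` lies in the slit plane.
[folklore] -/
theorem map_sub_mem_slitPlane (h : ShortTime W z t) : map W t z - W t ∈ slitPlane :=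
  mem_slitPlane_iff.2 (Or.inr h.im_map_sub_pos.ne')

/-- **The spin-5/8 observable `s ↦ N_s(iy) = exp((5/8)(2 Log(iy) + Log g_s'(iy) - 2 Log(g_s(iy) - W_s)))`
is continuous on `[0, t]`** in the short-time regime `9t ≤ y²`: both arguments of the
principal logarithm stay in the slit plane (`deriv_map_mem_slitPlane`, `map_sub_mem_slitPlane`),
where `Log` is continuous — this is the branch "continuous in `s` from the value `1` at
`s = 0`" (CDHKS 2014, §3: "`M_t^δ(z)` are … equicontinuous … if `t ≤ (1/9)(Im w(z))²`").
[cite: CDHKSCRAS2014, §3] -/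
theorem continuousOn_sawParaObservable {y : ℝ} (h : ShortTime W (I * y) t) :
    ContinuousOn (fun s : ℝ≥0 ↦ cexp ((5 / 8 : ℂ) * (2 * log (I * y) +
      log (deriv (map W s) (I * y)) - 2 * log (map W s (I * y) - W s)))) (Icc 0 t) :=
  (continuousOn_const.mul ((continuousOn_const.add
    (h.continuousOn_deriv_map.clog fun _ hs ↦ (h.mono hs.2).deriv_map_mem_slitPlane)).sub
    (continuousOn_const.mul ((h.continuousOn_map.sub
      (continuous_ofReal.comp h.cont).continuousOn).clog
      fun _ hs ↦ (h.mono hs.2).map_sub_mem_slitPlane)))).cexp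

/-- **The spin-5/8 observable is bounded by `4`** on the imaginary axis in the short-time regime:
`|N_t(iy)| = exp((5/8)(2 log y + Re J - 2 log |g_t - W_t|))` with `Re J ≤ 1/2` and
`log (y/|g_t - W_t|) ≤ log (3/2) ≤ 1/2`, so `|N_t(iy)| ≤ e^{15/16} ≤ (e^{1/2})² ≤ 4` (CDHKS 2014,
§3: "`M_t^δ(z)` are uniformly bounded … if `t ≤ (1/9)(Im w(z))²`"). [cite: CDHKSCRAS2014, §3] -/
theorem norm_sawParaObservable_le {y : ℝ} (h : ShortTime W (I * y) t) :
    ‖cexp ((5 / 8 : ℂ) * (2 * log (I * y) + log (deriv (map W t) (I * y)) -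
      2 * log (map W t (I * y) - W t)))‖ ≤ 4 := by
  obtain ⟨g, hg⟩ := h.exists_sol
  have hy : 0 < y := by simpa using h.im_pos
  have hJ := h.norm_exponent_le hg
  set J := ∫ s in (0 : ℝ)..t, (-2 : ℂ) / ((g s - W s.toNNReal) * (g s - W s.toNNReal)) with hJdef
  have hD : Real.log ‖deriv (map W t) (I * y)‖ = J.re := by
    rw [h.deriv_map_eq hg, norm_exp, Real.log_exp]
  have hG := h.norm_map_sub_lower
  have hIy : (I * (y : ℂ)).im = y := by simp
  rw [hIy] at hG
  have hG0 : 0 < ‖map W t (I * y) - W t‖ := by linarith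
  have hnorm : ‖I * (y : ℂ)‖ = y := by simp [abs_of_pos hy]
  have hlog : Real.log y - Real.log ‖map W t (I * y) - W t‖ ≤ 1 / 2 := by
    rw [← Real.log_div hy.ne' hG0.ne']
    have h1 : y / ‖map W t (I * y) - W t‖ ≤ 3 / 2 := by
      rw [div_le_iff₀ hG0]; linarith
    linarith [Real.log_le_sub_one_of_pos (show 0 < y / ‖map W t (I * y) - W t‖ by positivity)]
  have hre : ((5 / 8 : ℂ) * (2 * log (I * y) + log (deriv (map W t) (I * y)) -
      2 * log (map W t (I * y) - W t))).re ≤ 1 / 2 + 1 / 2 := by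
    have h58 : (5 / 8 : ℂ) = ((5 / 8 : ℝ) : ℂ) := by norm_num
    have h2 : (2 : ℂ) = ((2 : ℝ) : ℂ) := by norm_num
    rw [h58, re_ofReal_mul, sub_re, add_re, h2, re_ofReal_mul, re_ofReal_mul, log_re, log_re,
      log_re, hnorm, hD]
    linarith [re_le_norm J]
  rw [norm_exp]
  calc Real.exp ((5 / 8 : ℂ) * (2 * log (I * y) + log (deriv (map W t) (I * y)) -
        2 * log (map W t (I * y) - W t))).re
      ≤ Real.exp (1 / 2 + 1 / 2) := Real.exp_le_exp.2 hre
    _ = Real.exp (1 / 2) * Real.exp (1 / 2) := Real.exp_add _ _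
    _ ≤ 2 * 2 := mul_le_mul exp_half_le_two exp_half_le_two (Real.exp_pos _).le zero_le_two
    _ = 4 := by norm_num

end ShortTime

variable {W : ℝ≥0 → ℝ}

/-- **The time-limited path `s ↦ N_{s ∧ T}(iy)` of the spin-5/8 observable is continuous on
`[0, ∞)`** whenever `[0, T]` is in the short-time regime at `iy` (e.g. `T = y²/9` or `T = y²/16`).
[folklore] -/
theorem continuous_sawParaObservable_min {y : ℝ} {T : ℝ≥0} (h : ShortTime W (I * y) T) :
    Continuous fun s : ℝ≥0 ↦ cexp ((5 / 8 : ℂ) * (2 * log (I * y) +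
      log (deriv (map W (min s T)) (I * y)) - 2 * log (map W (min s T) (I * y) - W (min s T)))) :=
  h.continuousOn_sawParaObservable.comp_continuous (continuous_id.min continuous_const)
    fun _ ↦ ⟨bot_le, min_le_right _ _⟩

/-- The time-limited spin-5/8 observable `N_{s ∧ T}(iy)` is bounded by `4` (`[0, T]` in the
short-time regime at `iy`). [folklore] -/
theorem norm_sawParaObservable_min_le {y : ℝ} {T : ℝ≥0} (h : ShortTime W (I * y) T) (s : ℝ≥0) :
    ‖cexp ((5 / 8 : ℂ) * (2 * log (I * y) + log (deriv (map W (min s T)) (I * y)) -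
      2 * log (map W (min s T) (I * y) - W (min s T))))‖ ≤ 4 :=
  (h.mono (min_le_right s T)).norm_sawParaObservable_le

end Loewner

end Literature.Probability.RandomPlanarGeometry
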